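/- Copyright: the b2b-balaban cell (near-miss cell 7), T⁴-continuum fan-out; row NE7b CRUX team (2), seat
t4-ne7b-formalise-leaf-05 (gen 31) — item (C) of the row OWNER's INTERFACE REQUEST NE7b IR-46-1 ∕ IR-45-1 («→ S12-W crew
(leaf-03 custodian; E-side leaf-02; leaf-05) … (C) leaf-05: the junction SANITY toy», HOME/INBOX.md l.8656 ∕ l.8971,
`CLAIMS.log` l.31515 (D) ∕ l.31568 (d) ∕ booking l.31533).  Released under the licence of the surrounding project. -/
import Summits.QuantumFields.BalabanUV.T4Continuum.Support.HistoryRealiseCellsRunSupplyWTVS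
import Summits.QuantumFields.BalabanUV.T4Continuum.Support.B16HistoryInputFamilySanity

/-!
# Sanity for the (α) supplier plug over M2 brick B (companion of `HistoryRealiseCellsRunSupplyWTVS`; INTERFACE
REQUEST NE7b IR-46-1 (C), lineage `t4-ne7b-formalise-leaf-05` gen 31)

Summits-side support leaf of the T⁴-continuum cell (rung (B)+1 on a FINITE torus only; NOT infinite volume, NOT the
mass gap, NOT Clay; NOT a proof of NE7b — the cell's OWN estimate, NOT PRINTED, NOT PROVED).  [folklore] decided toy
arithmetic over M1's sanity skeleton (`B16HistoryIndexedRepr.Sanity.toyI`; `SanityInput.toy1` ∕ `Isk` ∕ `Φ₀` ∕ `μ₀` of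
leaf-04's `B16HistoryInputFamilySanity`, REUSED BY NAME) and the lineage's member ∕ key ∕ fibre carriers (`memOf`,
`kmemOf`, `fibre`, `badGMems`); nothing printed asserted, no `def … : Prop` fact, no cite-tagged hypothesis, zero `sorry`.

THE ONE-TERM TOY READING `ℛ₁` (§1–§2): every cutoff carries M1's skeleton; the reading names NO large-field region
(`N ≡ ∅`, `F ≡ ∅`), flow `L = 4`, `s ≡ 0`, `R ≡ 2`, memory `Rm ≡ 2` — the least letters meeting the plug's displayed process
conditions `4 ≤ L`, `2 ≤ Rm t 1`, `Rm t (k+1) ≤ R (t+1)`, `1 ≤ R`; factor data = leaf-04's unit data `Φ₀`; Dirac reference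
mass `μ₀`.  KERNEL-DECIDED: (S0) a run with no new region has NO DISSOLVED component and nothing dies in the pass-V
bookkeeping (`comp_histV_eq_empty_of_N`, `died_histV_eq_empty_of_N` — any `RunInputM`); (S1) `HistRead ℛ₁ Φ₀ toy1 1 0`
and EVERY displayed binder of `upM_of_reading` hold on the toy AT ONCE — process conditions, `DropCtl`, the volume
calibration at `Λ ≡ 1` with `Lu = 1`, `j = 20` (`1122·16·21 ≤ 2²⁰∕2` decided), toy constants `C₂` (`n₁ = 13`, `E₂ = 1`,
`E₃ = 0` — TOY symbols, c2), nonnegative factors, curly envelope `W ≡ 2`, the one-sided key reading at `FcM ≡ 1` (empty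
LIVE product); (S2) on the term `τ₀ = ⟨0, false, (0, (), 0)⟩`: `deadOf = 1∕2`, `nupOf = 2`, and
`weight_le_deadOf_mul_mul_nupOf` RETURNS `weight ≤ (1∕2)·1·2 = 1 = weight` (`SanityInput.weight_toy`) — the chain M1 → M2-A →
M2-B → P computes end to end and is SHARP; (S2′) `upM_of_reading`, `deadM_nonneg_of_reading`, `resumM_of_fibreMass`
instantiate BY NAME on `ℛ₁` (conclusions over the bad key classes — EMPTY on a reading without regions, `badGMems_toy`:
the junction is live, its content nil by design).

THE TWO-TERM KEY FIBRE (§3, R-OWNER-46-1 (d)(C) «(ρ) with `MULT = 1`, `W = 1` FAILS and with `W = 2` holds (decided)»):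
two terms `0, 1 : Fin 2` (two sub-history choices of ONE outer summand reading the same physical structure) each read ONE
live component with the one-birth pedigree `P1` (a class-`0` region born at step `0`) at the same root cell and physical
datum: common key family `k₀`, both BAD at every cutoff `K ≥ 2` (`rootStep 0 < jhalf K`), key fibre = both terms, fibre
mass `2` at unit mass per term; the display (ρ) in the END's binder shape FAILS at `W = 1`, `MULT ≡ 1` (`fibreMass_fails`)
and HOLDS at `W = 2` (`fibreMass_holds`) — the spec change of R-OWNER-46-1 (b) (`RfM := 1` withdrawn) is NOT VACUOUS.
HONEST LIMIT: (S3) lives on the ABSTRACT member ∕ key ∕ fibre carriers (the shape of P's hypothesis `hρ` at any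
`ped`∕`liveC`∕`cellOf`∕`phys`∕`T`), not on a `HistReading` run to a cutoff `K ≥ 2` with a persistent region (that twin
needs continuation lemmas of the memory-generic process beyond level `0`; left to a sequel).

HONEST.  Proves nothing of Bałaban's; every display of IR-45-1 ∕ IR-46-1 (`HistRead`, `FactorRead` ∕ `RoundingRoomF`, the
volume calibration, (ρ) `FibreMass`, `W∞`, the pass-V process conditions, `FlowIneq29`) stays an R-class HYPOTHESIS of
the plug — this file shows they are jointly consistent and the junction live and sharp on the trivial reading; BY-NAME
EFFECT ON THE WALL: NONE; NE7b NOT proved; spine 0∕9.  HONEST DEPENDENCY (cell): continuum YM on T⁴ ⇐ BetaPertH ∧ nine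
spine estimates (0/9 proved); BetaPertH ⇐ (D1) ∧ (D4) ∧ CAP+tail; G-an2-4 gates asym, D1 and NE2/3/4.  Unchanged here.
-/

open Finset MeasureTheory
open Literature.MathematicalPhysics.QuantumFieldTheory.Balaban1983to89
open Literature.MathematicalPhysics.QuantumFieldTheory.Balaban1983to89.B16SProfile (DropCtl)
open T4PersistenceDictionary T4PrintedShapeBanking T4TaggedShapeBanking T4BankedInduction T4PartnerMultiplicity
open T4LiveClassFibration T4RenewalChains
open Summit.QuantumFields.BalabanUV.T4Continuum.HistoryAdmissible
open Summit.QuantumFields.BalabanUV.T4Continuum.HistoryGen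
open Summit.QuantumFields.BalabanUV.T4Continuum.HistoryGenealogyExtraction
open Summit.QuantumFields.BalabanUV.T4Continuum.HistoryGenealogyRealise
open Summit.QuantumFields.BalabanUV.T4Continuum.HistoryGenealogyInstantiate
open Summit.QuantumFields.BalabanUV.T4Continuum.HistoryGenealogyPedigree
open Summit.QuantumFields.BalabanUV.T4Continuum.HistoryAssemblyPedigree Summit.QuantumFields.BalabanUV.T4Continuum.HistoryAssemblyTerms
open Summit.QuantumFields.BalabanUV.T4Continuum.HistoryAssemblyMult Summit.QuantumFields.BalabanUV.T4Continuum.HistoryAssemblyMultKey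
open Summit.QuantumFields.BalabanUV.T4Continuum.B16HistoryIndexedRepr
open Summit.QuantumFields.BalabanUV.T4Continuum.HistoryBankingLE Summit.QuantumFields.BalabanUV.T4Continuum.HistoryBankingVolumePlug
open Summit.QuantumFields.BalabanUV.T4Continuum.HistoryBankingCreditRead Summit.QuantumFields.BalabanUV.T4Continuum.HistoryRealiseCellsRunSupplyWTVS

/-! ## (S0) A run with no new region has no dissolved component, and nothing dies -/

namespace Summit.QuantumFields.BalabanUV.T4Continuum.HistoryGenealogyInstantiate.RunInputM

variable {d : ℕ} (J : RunInputM d)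

/-- **A RUN WITH NO NEW REGION HAS NO DISSOLVED COMPONENT** at any level (`histV` keeps the non-fresh real components —
none, `comp_histM_eq_empty_of_N` — and adds the regions of fresh clusters — none). [folklore] -/
theorem comp_histV_eq_empty_of_N (hN : ∀ ℓ, J.N ℓ = ∅) (ℓ : ℕ) : J.histV.comp ℓ = ∅ := by
  ext x
  simp only [Finset.notMem_empty, iff_false]
  intro hx
  rcases (ComponentHistory.mem_comp_dissolve_iff _ _).1 hx with ⟨h, -⟩ | h
  · rw [J.comp_histM_eq_empty_of_N hN ℓ] at h
    exact Finset.notMem_empty _ h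
  · obtain ⟨c, hc, -⟩ := (ComponentHistory.mem_pseudo_iff _).1 h
    have h1 := hc.1
    rw [J.comp_histM_eq_empty_of_N hN ℓ] at h1
    exact Finset.notMem_empty _ h1

/-- … and nothing dies in it. [folklore] -/
theorem died_histV_eq_empty_of_N (hN : ∀ ℓ, J.N ℓ = ∅) (ℓ : ℕ) : J.histV.died ℓ = ∅ := by
  rw [ComponentHistory.died, J.comp_histV_eq_empty_of_N hN ℓ, Finset.empty_sdiff]

end Summit.QuantumFields.BalabanUV.T4Continuum.HistoryGenealogyInstantiate.RunInputM

namespace Summit.QuantumFields.BalabanUV.T4Continuum.HistoryRealiseCellsRunSupplyWTVSSanity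

noncomputable section

open B16HistoryIndexedRepr.Sanity B16HistoryIndexedRepr.SanityInput

-- the structural `DecidableEq` instance of the concrete tag type exceeds the default synthesis size (as in
-- `HistoryRealiseCellsRunSupplyWTVS` ∕ `B16HistoryPricePlug`)
set_option synthInstance.maxSize 1024

/-! ## (S1) The one-term toy reading `ℛ₁` and the joint inhabitation of the plug's displayed binders -/

/-- **THE TOY READING**: no new region, no new field; flow `L = 4`, `s ≡ 0`, `R ≡ 2`, memory `Rm ≡ 2` (dimension `1`,
skeleton `Isk ≡ toyI`). [folklore] -/
def ℛ₁ : HistReading Isk 1 where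
  L := 4
  s _ _ := 0
  R _ _ := 2
  Rm _ _ _ := 2
  N _ _ _ _ := ∅
  cls _ _ _ _ := 0
  F _ _ _ _ := ∅

/-- **TOY MODEL CONSTANTS** `(n₁, dC, q′, E₂, E₃, κ₁, E₀, Eb, μ, a, A₀, p₀) = (13, 0, 1, 1, 0, 0, 0, 0, 0, 0, 1, 1)` — TOY
symbols meeting the plug's `13 ≤ n₁`, `0 ≤ E₂`, `0 ≤ E₃`; not print's values (c2). [folklore] -/
def C₂ : T4PrintedShapeBanking.Consts := ⟨13, 0, 1, 1, 0, 0, 0, 0, 0, 0, 1, 1⟩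

/-- the runs read off `ℛ₁` name no region, hence have no dissolved component at any level [folklore] -/
theorem comp_run_eq_empty (K : ℕ) (τ : HIndex.Idx Isk) (j : ℕ) : (ℛ₁.inputOf.run K τ).histV.comp j = ∅ :=
  (ℛ₁.inputOf.run K τ).comp_histV_eq_empty_of_N (fun _ => rfl) j

/-- the same for the run read off a history choice [folklore] -/
theorem comp_runOf_eq_empty (K : ℕ) (a : (Isk K).Adm) (ι : (Isk K).HZ × (Isk K).HL × (Isk K).HC) (j : ℕ) :
    (ℛ₁.runOf K a ι).histV.comp j = ∅ :=
  (ℛ₁.runOf K a ι).comp_histV_eq_empty_of_N (fun _ => rfl) j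
/-- … and nothing dies [folklore] -/
theorem died_runOf_eq_empty (K : ℕ) (a : (Isk K).Adm) (ι : (Isk K).HZ × (Isk K).HL × (Isk K).HC) (j : ℕ) :
    (ℛ₁.runOf K a ι).histV.died j = ∅ :=
  (ℛ₁.runOf K a ι).died_histV_eq_empty_of_N (fun _ => rfl) j
/-- the real bookkeeping has no component either [folklore] -/
theorem compM_runOf_eq_empty (K : ℕ) (a : (Isk K).Adm) (ι : (Isk K).HZ × (Isk K).HL × (Isk K).HC) (j : ℕ) :
    (ℛ₁.runOf K a ι).histM.comp j = ∅ :=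
  (ℛ₁.runOf K a ι).comp_histM_eq_empty_of_N (fun _ => rfl) j

/-- **`HistRead` HOLDS ON THE TOY** (source radius `1`, threshold `0`): envelopes attained, the identification reads
`1 · 1 ≤ 1` (empty forest). [folklore] -/
theorem histRead_toy : HistRead ℛ₁ Φ₀ (fun _ _ => toy1) 1 0 where
  χ01 _ _ _ _ := ⟨zero_le_one, le_rfl⟩
  tz_le _ _ _ _ _ _ _ _ := le_of_eq rfl
  ty_le _ _ _ _ _ _ _ _ := le_of_eq rfl
  tc_le _ _ _ _ _ _ _ _ := le_of_eq rfl
  A'_le _ _ _ _ _ := le_rfl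
  Vs_le _ _ _ _ _ _ _ _ _ := le_rfl
  forest_le K t _ _ a ι _ := by
    show (1 : ℝ) * 1 ≤ _
    rw [Finset.prod_congr rfl fun j _ => by rw [compM_runOf_eq_empty K a ι j, Finset.prod_empty], Finset.prod_const_one]
    norm_num

/-- the displayed input condition `NewOK` (vacuous) [folklore] -/
theorem newOK_run (K : ℕ) (τ : HIndex.Idx Isk) : (ℛ₁.inputOf.run K τ).NewOK :=
  ⟨fun _ _ hn => by simp [HistReading.inputOf, ℛ₁] at hn⟩
/-- disjoint new regions (vacuous) [folklore] -/
theorem newDisjoint_run (K : ℕ) (τ : HIndex.Idx Isk) : (ℛ₁.inputOf.run K τ).NewDisjoint :=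
  fun _ _ hn => by simp [HistReading.inputOf, ℛ₁] at hn

/-- memory domination `Rm ≤ R` (`2 ≤ 2`) [folklore] -/
theorem rm_le_run (K : ℕ) (τ : HIndex.Idx Isk) : ∀ t k, (ℛ₁.inputOf.run K τ).Rm t k ≤ (ℛ₁.inputOf.run K τ).R t :=
  fun _ _ => le_rfl
/-- its one-step form [folklore] -/
theorem rmS_run (K : ℕ) (τ : HIndex.Idx Isk) :
    ∀ t k, (ℛ₁.inputOf.run K τ).Rm t (k + 1) ≤ (ℛ₁.inputOf.run K τ).R (t + 1) := fun _ _ => le_rfl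
/-- non-degenerate memory `2 ≤ Rm t 1` [folklore] -/
theorem rm2_run (K : ℕ) (τ : HIndex.Idx Isk) : ∀ t, 2 ≤ (ℛ₁.inputOf.run K τ).Rm t 1 := fun _ => le_rfl

/-- drop control of the constant exponents `s ≡ 0` [folklore] -/
theorem dropCtl_toy (K m : ℕ) : DropCtl (ℛ₁.s K) m := fun _ _ _ _ => by
  show 2 * 0 ≤ 2 * 0 + max _ 2
  omega

/-- **THE VOLUME CALIBRATION AT `Λ ≡ 1`** (`log Λ = 0`): the doubling display with `Lu = 1`, any `j` [folklore] -/
theorem hLu_toy (K j : ℕ) : ∀ t i, i ≤ j → Real.log (Φ₀.Λ K (t + i)) ≤ 1 * Real.log (Φ₀.Λ K t) := fun _ _ _ => by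
  simp [Φ₀]

/-- the smallness display `1122^d·16·21^d·Lu ≤ 2^j∕2` at `d = 1`, `Lu = 1`, `j = 20` — DECIDED (`376992 ≤ 524288`) [folklore] -/
theorem hsmall_toy : (1122 : ℝ) ^ 1 * 16 * 21 ^ 1 * 1 ≤ 2 ^ 20 / 2 := by norm_num
/-- the per-cube cost against the floor (`0 ≤ floorK`, `E₂ = 1 ≥ 0`) [folklore] -/
theorem huΦ_toy (K : ℕ) : ∀ t, t ≤ K →
    Real.log (Φ₀.Λ K t) * (6 * (561 ^ 1 * (20 : ℕ) * (1 : ℝ) + 1122 ^ 1 * 1)) ≤ floorK C₂ K (ℛ₁.R K) t := fun t _ => by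
  have h0 : 0 ≤ floorK C₂ K (ℛ₁.R K) t := floorK_nonneg (C := C₂) (K := K) (R := ℛ₁.R K) (by norm_num [C₂]) t
  simpa [Φ₀] using h0

/-- the per-cube cost against `E₂·R^{q′}` [folklore] -/
theorem huE₂_toy (K : ℕ) : ∀ n, n ≤ K → Real.log (Φ₀.Λ K n) * (15 * 126 ^ 1) ≤ C₂.E₂ * (ℛ₁.R K n : ℝ) ^ C₂.q' :=
  fun _ _ => by simp [Φ₀, C₂, ℛ₁]
/-- the per-cube cost against `E₃·R^{q′}` (`E₃ = 0`: both sides vanish) [folklore] -/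
theorem huE₃_toy (K : ℕ) : ∀ n, n ≤ K → Real.log (Φ₀.Λ K n) * (24 * 126 ^ 1) ≤ C₂.E₃ * (ℛ₁.R K n : ℝ) ^ C₂.q' :=
  fun _ _ => by simp [Φ₀, C₂]

/-- the key family of every term is EMPTY (no live component) … [folklore] -/
theorem kmemOf_toy {γ δ : Type*} [DecidableEq γ] [DecidableEq δ] (cellOf : ℕ → HIndex.Idx Isk → ℕ × Lab 1 → γ)
    (phys : ℕ → HIndex.Idx Isk → ℕ × Lab 1 → δ) (K : ℕ) (τ : HIndex.Idx Isk) :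
    kmemOf ℛ₁.inputOf.pedV ℛ₁.inputOf.liveCV cellOf phys K τ = ∅ := by
  unfold kmemOf
  rw [show ℛ₁.inputOf.liveCV K τ = ∅ from by
    show ((ℛ₁.inputOf.run K τ).histV.comp K).image (Prod.mk K) = ∅
    rw [comp_run_eq_empty, Finset.image_empty], Finset.image_empty]

/-- … so is the member family … [folklore] -/
theorem memOf_toy {γ : Type*} [DecidableEq γ] (cellOf : ℕ → HIndex.Idx Isk → ℕ × Lab 1 → γ) (K : ℕ)
    (τ : HIndex.Idx Isk) : memOf ℛ₁.inputOf.pedV ℛ₁.inputOf.liveCV cellOf K τ = ∅ := by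
  unfold memOf
  rw [show ℛ₁.inputOf.liveCV K τ = ∅ from by
    show ((ℛ₁.inputOf.run K τ).histV.comp K).image (Prod.mk K) = ∅
    rw [comp_run_eq_empty, Finset.image_empty], Finset.image_empty]

/-- NO term is bad [folklore] -/
theorem badTerms_toy {γ : Type*} [DecidableEq γ] (cellOf : ℕ → HIndex.Idx Isk → ℕ × Lab 1 → γ) (jstar : ℕ → ℕ)
    (K : ℕ) : badTerms (memOf ℛ₁.inputOf.pedV ℛ₁.inputOf.liveCV cellOf) jstar (HIndex.termSet Isk) K = ∅ :=
  Finset.filter_eq_empty_iff.2 fun τ _ => by rw [memOf_toy]; simp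

/-- … and there is NO bad key class: the witness-shaped fields are vacuous on the toy, by design. [folklore] -/
theorem badGMems_toy {γ δ : Type*} [DecidableEq γ] [DecidableEq δ] (cellOf : ℕ → HIndex.Idx Isk → ℕ × Lab 1 → γ)
    (phys : ℕ → HIndex.Idx Isk → ℕ × Lab 1 → δ) (jstar : ℕ → ℕ) (K : ℕ) :
    badGMems (memOf ℛ₁.inputOf.pedV ℛ₁.inputOf.liveCV cellOf) jstar (HIndex.termSet Isk)
      (kmemOf ℛ₁.inputOf.pedV ℛ₁.inputOf.liveCV cellOf phys) K = ∅ := by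
  rw [badGMems, badTerms_toy, Finset.image_empty]

/-- **THE ONE-SIDED KEY READING at `FcM ≡ 1`**: M2-B's LIVE product of every term is EMPTY (`= 1 ≤ 1`). [folklore] -/
theorem hFcM_toy {γ δ : Type*} [DecidableEq γ] [DecidableEq δ] (cellOf : ℕ → HIndex.Idx Isk → ℕ × Lab 1 → γ)
    (phys : ℕ → HIndex.Idx Isk → ℕ × Lab 1 → δ) (K : ℕ) :
    ∀ τ ∈ HIndex.termSet Isk K, ∏ x ∈ (ℛ₁.inputOf.run K τ).histV.comp K,
        Real.exp (lifeCost (dictWT Prod.fst (ℛ₁.R K) C₂.n₁) (costT Prod.fst C₂ K (ℛ₁.R K))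
            ((ℛ₁.inputOf.run K τ).pedMV.genT (K, x))) *
          Real.exp (birthWT Prod.fst (fun n => 2 ^ (1 + 3) * Real.log (Φ₀.Λ K n))
            ((ℛ₁.inputOf.run K τ).pedMV.genT (K, x))) *
          evProd (Φ₀.fB K) (Φ₀.fR K) ((ℛ₁.inputOf.run K τ).pedMV.toPGen id (K, x)) ≤
      (fun _ _ => (1 : ℝ)) K (kmemOf ℛ₁.inputOf.pedV ℛ₁.inputOf.liveCV cellOf phys K τ) := fun τ _ => by
  rw [comp_run_eq_empty, Finset.prod_empty]

/-! ## (S2) The numerator reading computes and is SHARP on the term `⟨0, false, (0, (), 0)⟩` -/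

/-- THE TOY TERM: cutoff `0`, the all-small summand, history choice `(0, (), 0)` [folklore] -/
abbrev τ₀ : HIndex.Idx Isk := ⟨0, false, ((0 : Fin 2), (), (0 : Fin 2))⟩

/-- the all-small summand's history choice `(0, (), 0)` is an index of the cutoff-`0` skeleton [folklore] -/
theorem hι₀ : (((0 : Fin 2), (), (0 : Fin 2)) : (Isk 0).HZ × (Isk 0).HL × (Isk 0).HC) ∈ (Isk 0).LIdx false := by
  decide

/-- **THE DEAD WEIGHT OF THE TOY TERM IS `1∕W`** (no dead genealogy, curly envelope `|1|`, last exponent `e⁰`). [folklore] -/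
theorem deadOf_toy (W : ℕ → ℝ) (t : ℝ) : deadOf ℛ₁ Φ₀ W 0 t τ₀ = 1 / W 0 := by
  simp only [deadOf, dmassOf, Finset.range_zero, Finset.prod_empty, one_mul]
  simp [Φ₀]

/-- **THE TERM-FREE ENVELOPE OF THE TOY IS `W`** (`e⁰ · 1 · W`; Dirac mass `1`). [folklore] -/
theorem nupOf_toy (W : ℕ → ℝ) (t : ℝ) : nupOf Φ₀ (fun K => (μ₀ K).real Set.univ) W 0 t = W 0 := by
  simp [nupOf, Φ₀, μ₀]

/-- **(S2) `weight_le_deadOf_mul_mul_nupOf` INSTANTIATED BY NAME ON THE TOY** (`W ≡ 2`, `FcM ≡ 1`, trivial root-cell ∕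
physical readings): EVERY displayed binder discharged at once — the plug's hypothesis set is JOINTLY INHABITED. [folklore] -/
theorem weight_le_toy :
    Repr172R.weight μ₀ (fun _ _ => toy1) 0 τ₀ ≤
      deadOf ℛ₁ Φ₀ (fun _ => 2) 0 0 τ₀ *
        (fun _ _ => (1 : ℝ)) 0 (kmemOf ℛ₁.inputOf.pedV ℛ₁.inputOf.liveCV (fun _ _ _ => (0 : ℕ)) (fun _ _ _ => ()) 0 τ₀) *
        nupOf Φ₀ (fun K => (μ₀ K).real Set.univ) (fun _ => 2) 0 0 :=
  weight_le_deadOf_mul_mul_nupOf ℛ₁ Φ₀ μ₀ (fun _ _ => toy1) histRead_toy (le_refl 0) (K := 0) (t := 0) (by norm_num)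
    false hι₀ (newOK_run 0 τ₀) (rm_le_run 0 τ₀) (rmS_run 0 τ₀) (rm2_run 0 τ₀) (newDisjoint_run 0 τ₀) (by norm_num [ℛ₁])
    (le_of_eq rfl) (dropCtl_toy 0) (fun _ => by norm_num [ℛ₁]) (C := C₂) (le_of_eq rfl) (by norm_num [C₂]) (le_of_eq rfl)
    one_pos (j := 20) (by norm_num) (hLu_toy 0 20) hsmall_toy (huΦ_toy 0) (huE₂_toy 0) (huE₃_toy 0)
    (fun _ _ _ => zero_le_one) (fun _ => zero_le_one) (W := fun _ => 2) two_pos (fun _ _ _ => (0 : ℕ)) (fun _ _ _ => ())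
    (FcM := fun _ _ => (1 : ℝ)) (by rw [comp_runOf_eq_empty, Finset.prod_empty])

/-- **(S2) … AND THE BOUND IS ATTAINED**: `deadOf · FcM · nupOf = (1∕2)·1·2 = 1 = weight` (`SanityInput.weight_toy`) —
the chain M1 → M2-A → M2-B → P computes end to end and is SHARP on the trivial reading. [folklore] -/
theorem weight_le_toy_sharp :
    deadOf ℛ₁ Φ₀ (fun _ => 2) 0 0 τ₀ *
        (fun _ _ => (1 : ℝ)) 0 (kmemOf ℛ₁.inputOf.pedV ℛ₁.inputOf.liveCV (fun _ _ _ => (0 : ℕ)) (fun _ _ _ => ()) 0 τ₀) *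
        nupOf Φ₀ (fun K => (μ₀ K).real Set.univ) (fun _ => 2) 0 0 =
      Repr172R.weight μ₀ (fun _ _ => toy1) 0 τ₀ := by
  rw [deadOf_toy, nupOf_toy, show Repr172R.weight μ₀ (fun _ _ => toy1) 0 τ₀ = 1 from weight_toy]
  norm_num

/-! ## (S2′) The witness-shaped fields instantiate BY NAME on the toy reading -/

/-- **`upM_of_reading` ON THE TOY** (any cutoff, `|t| ≤ 1`, trivial root-cell ∕ physical readings, any `jstar`): every
displayed binder discharged; the conclusion ranges over the bad key classes — none here (`badGMems_toy`). [folklore] -/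
theorem upM_toy (K : ℕ) {t : ℝ} (ht : |t| ≤ 1) (jstar : ℕ → ℕ) :
    ∀ k ∈ badGMems (memOf ℛ₁.inputOf.pedV ℛ₁.inputOf.liveCV (fun _ _ _ => (0 : ℕ))) jstar (HIndex.termSet Isk)
        (kmemOf ℛ₁.inputOf.pedV ℛ₁.inputOf.liveCV (fun _ _ _ => (0 : ℕ)) (fun _ _ _ => ())) K,
      ∀ τ ∈ fibre (kmemOf ℛ₁.inputOf.pedV ℛ₁.inputOf.liveCV (fun _ _ _ => (0 : ℕ)) (fun _ _ _ => ()))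
          (HIndex.termSet Isk) K k,
        Repr172R.weight μ₀ (fun _ _ => toy1) t τ ≤
          deadOf ℛ₁ Φ₀ (fun _ => 2) K t τ * (fun _ _ => (1 : ℝ)) K k *
            nupOf Φ₀ (fun K => (μ₀ K).real Set.univ) (fun _ => 2) K t :=
  upM_of_reading ℛ₁ Φ₀ μ₀ (fun _ _ => toy1) histRead_toy (Nat.zero_le K) (K := K) ht (fun τ _ => newOK_run K τ)
    (fun τ _ => rm_le_run K τ) (fun τ _ => rmS_run K τ) (fun τ _ => rm2_run K τ) (fun τ _ => newDisjoint_run K τ)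
    (by norm_num [ℛ₁]) (le_of_eq rfl) (dropCtl_toy K) (fun _ => by norm_num [ℛ₁]) (C := C₂) (le_of_eq rfl)
    (by norm_num [C₂]) (le_of_eq rfl) one_pos (j := 20) (by norm_num) (hLu_toy K 20) hsmall_toy (huΦ_toy K)
    (huE₂_toy K) (huE₃_toy K) (fun _ _ _ => zero_le_one) (fun _ => zero_le_one) (W := fun _ => 2) two_pos
    (fun _ _ _ => (0 : ℕ)) (fun _ _ _ => ()) jstar (FcM := fun _ _ => (1 : ℝ))
    (hFcM_toy (fun _ _ _ => (0 : ℕ)) (fun _ _ _ => ()) K)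

/-- **`deadM_nonneg_of_reading` ON THE TOY.** [folklore] -/
theorem deadM_nonneg_toy (K : ℕ) (t : ℝ) (jstar : ℕ → ℕ) :
    ∀ k ∈ badGMems (memOf ℛ₁.inputOf.pedV ℛ₁.inputOf.liveCV (fun _ _ _ => (0 : ℕ))) jstar (HIndex.termSet Isk)
        (kmemOf ℛ₁.inputOf.pedV ℛ₁.inputOf.liveCV (fun _ _ _ => (0 : ℕ)) (fun _ _ _ => ())) K,
      ∀ τ ∈ fibre (kmemOf ℛ₁.inputOf.pedV ℛ₁.inputOf.liveCV (fun _ _ _ => (0 : ℕ)) (fun _ _ _ => ()))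
          (HIndex.termSet Isk) K k, 0 ≤ deadOf ℛ₁ Φ₀ (fun _ => 2) K t τ :=
  deadM_nonneg_of_reading ℛ₁ Φ₀ (K := K) (fun _ _ _ => zero_le_one) (fun _ => zero_le_one) (W := fun _ => 2) zero_le_two t
    (fun _ _ _ => (0 : ℕ)) (fun _ _ _ => ()) jstar

/-- **`resumM_of_fibreMass` ON THE TOY** at `MULT ≡ 1`: the display (ρ) is vacuous here (no bad key class), so the
`resumM` field follows BY NAME. [folklore] -/
theorem resumM_toy (K : ℕ) (t : ℝ) (jstar : ℕ → ℕ) :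
    ∀ k ∈ badGMems (memOf ℛ₁.inputOf.pedV ℛ₁.inputOf.liveCV (fun _ _ _ => (0 : ℕ))) jstar (HIndex.termSet Isk)
        (kmemOf ℛ₁.inputOf.pedV ℛ₁.inputOf.liveCV (fun _ _ _ => (0 : ℕ)) (fun _ _ _ => ())) K,
      ∑ τ ∈ fibre (kmemOf ℛ₁.inputOf.pedV ℛ₁.inputOf.liveCV (fun _ _ _ => (0 : ℕ)) (fun _ _ _ => ()))
          (HIndex.termSet Isk) K k, deadOf ℛ₁ Φ₀ (fun _ => 2) K t τ ≤ (fun _ _ => (1 : ℝ)) K k :=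
  resumM_of_fibreMass ℛ₁ Φ₀ (K := K) (W := fun _ => 2) two_pos t (fun _ _ _ => (0 : ℕ)) (fun _ _ _ => ()) jstar
    (MULT := fun _ _ => (1 : ℝ)) fun k hk => by
    rw [badGMems_toy] at hk
    exact absurd hk (Finset.notMem_empty k)

/-! ## (S3) The display (ρ) `FibreMass` is NON-VACUOUS and `W`-sensitive: a decided two-term key fibre -/

/-- the one-birth pedigree: ONE component `()`, step `0`, one new part of class `0` [folklore] -/
def P1 : Pedigree Unit Unit where
  step _ := 0
  parts _ := [Part.new 0 ()]
  step_lt c c' r h := by simp at h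

/-- its tagged genealogy: a bare birth at step `0` [folklore] -/
theorem genT_P1 : P1.genT () = Gen.born ((((0, 0, 0) : PEv)), Tag.birth () 0 0 ()) 0 := by
  rw [Pedigree.genT_eq]; rfl
/-- its flat genealogy [folklore] -/
theorem gen_P1 : P1.gen () = Gen.born ((0, 0, 0) : PEv) 0 := by
  rw [Pedigree.gen, genT_P1]; rfl

/-- TWO TERMS (two sub-history choices of one outer summand), all terms at every cutoff [folklore] -/
def T₂ : ℕ → Finset (Fin 2) := fun _ => Finset.univ
/-- both read the one-birth pedigree [folklore] -/
def ped₂ : ℕ → Fin 2 → Pedigree Unit Unit := fun _ _ => P1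
/-- with its component live [folklore] -/
def live₂ : ℕ → Fin 2 → Finset Unit := fun _ _ => {()}
/-- at the SAME root cell [folklore] -/
def cell₂ : ℕ → Fin 2 → Unit → ℕ := fun _ _ _ => 0
/-- with the SAME physical datum [folklore] -/
def phys₂ : ℕ → Fin 2 → Unit → Unit := fun _ _ _ => ()

/-- THE COMMON KEY FAMILY of the two terms [folklore] -/
def k₀ : Finset (ℕ × Gen PEv × Unit) := {((0 : ℕ), Gen.born ((0, 0, 0) : PEv) 0, ())}

/-- both terms have the key family `k₀` [folklore] -/
theorem kmemOf_two (K : ℕ) (τ : Fin 2) : kmemOf ped₂ live₂ cell₂ phys₂ K τ = k₀ := by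
  simp [kmemOf, keyOf, live₂, ped₂, cell₂, phys₂, gen_P1, k₀]

/-- both terms have the member family `{(0, genT)}`, whose member is born at step `0` [folklore] -/
theorem memOf_two (K : ℕ) (τ : Fin 2) :
    memOf ped₂ live₂ cell₂ K τ = {((0 : ℕ), Gen.born ((((0, 0, 0) : PEv)), Tag.birth () 0 0 ()) 0)} := by
  simp [memOf, live₂, ped₂, cell₂, genT_P1]

/-- **BOTH TERMS ARE BAD AT EVERY CUTOFF `K ≥ 2`** (their member is born at step `0 < jhalf K`). [folklore] -/
theorem badTerms_two {K : ℕ} (hK : 2 ≤ K) : badTerms (memOf ped₂ live₂ cell₂) jhalf T₂ K = Finset.univ := by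
  ext τ
  simp only [Finset.mem_univ, iff_true, mem_badTerms, T₂, memOf_two, Finset.mem_singleton, exists_eq_left,
    Gen.rootStep_born, true_and]
  unfold jhalf
  omega

/-- **THE BAD KEY CLASSES: exactly `k₀`** (`K ≥ 2`). [folklore] -/
theorem badGMems_two {K : ℕ} (hK : 2 ≤ K) :
    badGMems (memOf ped₂ live₂ cell₂) jhalf T₂ (kmemOf ped₂ live₂ cell₂ phys₂) K = {k₀} := by
  rw [badGMems, badTerms_two hK]
  ext k
  simp [kmemOf_two, eq_comm]

/-- **THE KEY FIBRE OF `k₀` IS BOTH TERMS.** [folklore] -/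
theorem fibre_two (K : ℕ) : fibre (kmemOf ped₂ live₂ cell₂ phys₂) T₂ K k₀ = Finset.univ := by
  ext τ
  simp [mem_fibre, T₂, kmemOf_two]

/-- so the fibre mass at unit mass per term is `2` [folklore] -/
theorem fibreMass_two (K : ℕ) : ∑ τ ∈ fibre (kmemOf ped₂ live₂ cell₂ phys₂) T₂ K k₀, (fun _ => (1 : ℝ)) τ = 2 := by
  rw [fibre_two, Finset.sum_const, Finset.card_univ, Fintype.card_fin]
  norm_num

/-- **(ρ) FAILS AT `W = 1`, `MULT ≡ 1`** (`K ≥ 2`): the display in the END's binder shape — `∀ k ∈ badGMems …,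
Σ_{τ ∈ fibre … k} dmass τ ≤ W · MULT K k` — is FALSE for unit fibre masses (`2 ≰ 1`): IR-45-1's `RfM := 1` is refuted. [folklore] -/
theorem fibreMass_fails {K : ℕ} (hK : 2 ≤ K) :
    ¬ ∀ k ∈ badGMems (memOf ped₂ live₂ cell₂) jhalf T₂ (kmemOf ped₂ live₂ cell₂ phys₂) K,
        ∑ τ ∈ fibre (kmemOf ped₂ live₂ cell₂ phys₂) T₂ K k, (fun _ => (1 : ℝ)) τ ≤
          (1 : ℝ) * (fun _ _ => (1 : ℝ)) K k := by
  intro h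
  have h1 := h k₀ (by rw [badGMems_two hK]; exact Finset.mem_singleton_self _)
  rw [fibreMass_two] at h1
  norm_num at h1

/-- **(ρ) HOLDS AT `W = 2`, `MULT ≡ 1`** (any cutoff): `2 ≤ 2·1` on the one bad key class, vacuously elsewhere. [folklore] -/
theorem fibreMass_holds (K : ℕ) :
    ∀ k ∈ badGMems (memOf ped₂ live₂ cell₂) jhalf T₂ (kmemOf ped₂ live₂ cell₂ phys₂) K,
      ∑ τ ∈ fibre (kmemOf ped₂ live₂ cell₂ phys₂) T₂ K k, (fun _ => (1 : ℝ)) τ ≤ (2 : ℝ) * (fun _ _ => (1 : ℝ)) K k := by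
  intro k hk
  obtain ⟨τ, -, rfl⟩ := mem_badGMems.1 hk
  rw [kmemOf_two, fibreMass_two]
  norm_num

end

end Summit.QuantumFields.BalabanUV.T4Continuum.HistoryRealiseCellsRunSupplyWTVSSanity
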